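import Summits.BirchSwinnertonDyer.Rank1Residual.X11b.Three.LambdaSupply
import Summits.BirchSwinnertonDyer.Rank1Residual.X11b.Three.LambdaSupplyTwistFamily
import Literature.NumberTheory.EllipticCurves.Rubin1991.TwoVariableMainConjecture
import HarnessLib

set_option linter.dupNamespace false
set_option autoImplicit false

/-!
# Crux `CycTangentCM.CycTangentBound` (stmt-BirchSwinnertonDyer-22628), refutation road:
# INTERPOLATION CHARACTERS THROUGH THE `ℤ_p²`-TOWER — powers of an algebraic Hecke character
# unramified outside `p` have `p`-adic avatars factoring through ANY generator pair

Lead seat `bsd-line-ctcm-p1` g0 (line `tangent-cone-parity`, falsifier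
`Cruxes/CycTangentBound/Lines/tangent_cone_parity_falsifier.md`). The kill criterion of the crux reads
`m₀ ≤ λ̄(G|_ℓ)` for a `ℤ_p`-line `ℓ` of the `ψ⁻¹`-twisted two-variable frame `IsKatzMeasure₂` through
the trivial character, with `λ̄(G|_ℓ)` certified from VALUES at typed interpolation points (tree
`IntSeries.isUnit_coeff_of_dualCertificate`, p583552). The typed points are pairs `(ρ, r)` with
`IsPAdicAvatarOf ι ρ r` and `FactorsThroughPair κ₁ κ₂ r`. This file supplies them GENERICALLY:

* `toAdd_eq_zero_of_isTopGeneratorPair` — for `K` imaginary quadratic, the common kernel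
  `pairKer κ₁ κ₂` of a GENERATOR PAIR (`ZpExtension.IsTopGeneratorPair`) is contained in the kernel of
  EVERY continuous `ℤ_p`-character of `Γ_K` (rank two: `LambdaSupply.exists_spanningPair` writes any
  character in a spanning pair `Φ₀, Φ₁`; evaluating `κ₁, κ₂` at `γ₁, γ₂` gives a `2 × 2` matrix over
  `ℤ_p` with unit determinant, so `Φ₀, Φ₁` are `ℤ_p`-combinations of `κ₁, κ₂`).
* `exists_isPAdicAvatarOf_pow_factorsThroughPair` — for `Ψ` ALGEBRAIC and UNRAMIFIED OUTSIDE `p`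
  there are `M > 0` and a continuous character `χ : Γ_K → ℚ̄_pˣ` such that for every `n`,
  `e ∘ χⁿ` is the `p`-adic avatar of `Ψ^{Mn}` (geometric convention of the frames) AND factors through
  the pair: Weil's character `a` of `Ψ` (`LambdaSupply.exists_weilValued`) raised to the power `M`
  kills the common kernel of the spanning pair (`LambdaSupply.PadicUnits.pow_eq_one_of_forall_character`:
  logarithm + rank two), hence `pairKer`; `χ = (a^M)⁻¹` read in `ℚ̄_p`; avatars of powers by
  `LambdaSupply.isPAdicAvatarOf_pow`.

USE (negative road of 22628): with `Ψ = ψ_A^{−w_K}` (unramified everywhere; `w_K = #μ_K`) the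
characters `ρ_t = Ψ^{Mt}` give the interpolation points `ε_t = ψ_A⁻¹ρ_t = ψ_A^{−(1+w_K M t)}` of type
`(−m_t, 0)` on ONE `ℤ_p`-line through the trivial character of the frame (the Katz `ψ`-power line),
at which the frame prescribes the Hurwitz-type values of the falsifier. THEOREMS ONLY; nothing about
any curve or measure is asserted; supports, does not close, stmt-BirchSwinnertonDyer-22628.

References: [Weil1956] §1–§2 (the `p`-adic avatar of a character of type `A₀`); [Washington1997]
§5.1, §13.1 and Thm. 13.4 (`ℤ_p`-rank `r₂ + 1 = 2` of an imaginary quadratic field; logarithms);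
[deShalit1987] II.4.17 (54) (characters of the `ℤ_p²`-tower as interpolation points).
-/

noncomputable section

open scoped NumberField Classical Topology
open Filter NumberField IsDedekindDomain Field
  Literature.NumberTheory.GaloisRepresentations Literature.NumberTheory.EllipticCurves
open Summit.BirchSwinnertonDyer.Rank1Residual.X11b
open Summit.BirchSwinnertonDyer.Rank1Residual.X11b.Three.LambdaSupply

namespace Summit.BirchSwinnertonDyer.BirchSwinnertonDyer.Theorems.CycTangentCMCycTangentBoundPairSupply

variable {K : Type} [Field K] [NumberField K] {p : ℕ} [Fact p.Prime]

/-- **The common kernel of a generator pair lies in the kernel of every `ℤ_p`-character** (`K`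
imaginary quadratic, `ℤ_p`-rank two). If `(κ₁, κ₂; γ₁, γ₂)` is a generator pair
(`κ₁ γ₁ = 1, κ₂ γ₁ = 0, κ₁ γ₂ = 0, κ₂ γ₂ = 1` additively) and `f : Γ_K →ₜ* ℤ_p` is continuous, then
`κ₁ σ = κ₂ σ = 0 ⟹ f σ = 0`: by `exists_spanningPair` `κᵢ = aᵢΦ₀ + bᵢΦ₁` and `f = aΦ₀ + bΦ₁`; the
evaluations at `γ₁, γ₂` give `(a₁b₂ − a₂b₁)·(x₁y₂ − x₂y₁) = 1`, so `a₁b₂ − a₂b₁ ∈ ℤ_pˣ` and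
`Φ₀ σ = Φ₁ σ = 0` whenever `κ₁ σ = κ₂ σ = 0`. [cite: Washington1997, §13.1 and Thm. 13.4] -/
theorem toAdd_eq_zero_of_isTopGeneratorPair (hK : Module.finrank ℚ K = 2)
    (himag : ∀ w : InfinitePlace K, w.IsComplex)
    {κ₁ κ₂ : ZpExtension K p} {γ₁ γ₂ : absoluteGaloisGroup K}
    (hpair : ZpExtension.IsTopGeneratorPair κ₁ κ₂ γ₁ γ₂)
    (f : absoluteGaloisGroup K →ₜ* Multiplicative ℤ_[p]) {σ : absoluteGaloisGroup K}
    (h₁ : κ₁ σ = 1) (h₂ : κ₂ σ = 1) : f σ = 1 := by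
  obtain ⟨Φ₀, Φ₁, -, hspan⟩ := exists_spanningPair (p := p) hK himag
  obtain ⟨a₁, b₁, hκ₁⟩ := hspan κ₁.toContinuousMonoidHom
  obtain ⟨a₂, b₂, hκ₂⟩ := hspan κ₂.toContinuousMonoidHom
  obtain ⟨a, b, hf⟩ := hspan f
  simp only [ZpExtension.coe_toContinuousMonoidHom] at hκ₁ hκ₂
  -- evaluations at the generators
  have e11 : (κ₁ γ₁).toAdd = 1 := by rw [hpair.left]; rfl
  have e21 : (κ₂ γ₁).toAdd = 0 := by rw [hpair.apply_left]; rfl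
  have e12 : (κ₁ γ₂).toAdd = 0 := by rw [hpair.apply_right]; rfl
  have e22 : (κ₂ γ₂).toAdd = 1 := by rw [hpair.right]; rfl
  rw [hκ₁] at e11 e12
  rw [hκ₂] at e21 e22
  set x₁ := (Φ₀ γ₁).toAdd
  set y₁ := (Φ₁ γ₁).toAdd
  set x₂ := (Φ₀ γ₂).toAdd
  set y₂ := (Φ₁ γ₂).toAdd
  -- the determinant is a unit
  have hdet : (a₁ * b₂ - a₂ * b₁) * (x₁ * y₂ - x₂ * y₁) = 1 := by
    linear_combination (a₂ * x₂ + b₂ * y₂) * e11 + e22 - (a₁ * x₂ + b₁ * y₂) * e21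
  -- at `σ`
  have s₁ : a₁ * (Φ₀ σ).toAdd + b₁ * (Φ₁ σ).toAdd = 0 := by rw [← hκ₁, h₁]; rfl
  have s₂ : a₂ * (Φ₀ σ).toAdd + b₂ * (Φ₁ σ).toAdd = 0 := by rw [← hκ₂, h₂]; rfl
  have hX : (Φ₀ σ).toAdd = 0 := by
    linear_combination (x₁ * y₂ - x₂ * y₁) * (b₂ * s₁ - b₁ * s₂) - (Φ₀ σ).toAdd * hdet
  have hY : (Φ₁ σ).toAdd = 0 := by
    linear_combination (x₁ * y₂ - x₂ * y₁) * (a₁ * s₂ - a₂ * s₁) - (Φ₁ σ).toAdd * hdet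
  have : (f σ).toAdd = 0 := by rw [hf, hX, hY, mul_zero, mul_zero, add_zero]
  exact toAdd_eq_zero.mp this

/-- **Interpolation characters through the `ℤ_p²`-tower.** For `K` imaginary quadratic
(`[K:ℚ] = 2`, all infinite places complex), `ι : ℚ̄_p ≃ ℂ`, an ALGEBRAIC Hecke character `Ψ` of
`K` UNRAMIFIED OUTSIDE `p`, and any generator pair `(κ₁, κ₂; γ₁, γ₂)`: there are `M > 0` and a
continuous character `χ : Γ_K → ℚ̄_pˣ` such that for every `n : ℕ` the rank-one representation
`e ∘ χⁿ` is the `p`-adic avatar of `Ψ^{M·n}` (`IsPAdicAvatarOf`, geometric convention) and FACTORS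
THROUGH THE PAIR (`FactorsThroughPair κ₁ κ₂`). So the points `(Ψ^{Mn}, e ∘ χⁿ)`, `n ≥ 0`, are
admissible `(ρ, r)` in the two-variable frames `IsKatzMeasure₂ … κ₁ κ₂ γ₁ γ₂ …` — a `ℤ_p`-LINE of
interpolation points through the trivial character (`n = 0`), with `r_n(γ) = r_1(γ)ⁿ`.
[cite: Weil1956, §1–§2] [cite: Washington1997, §5.1, §13.1, Thm. 13.4] [cite: deShalit1987, II.4.17 (54) (p. 78)] -/
theorem exists_isPAdicAvatarOf_pow_factorsThroughPair (ι : PadicAlgCl p ≃+* ℂ)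
    (hK : Module.finrank ℚ K = 2) (himag : ∀ w : InfinitePlace K, w.IsComplex)
    {Ψ : HeckeCharacter K} (hΨa : Ψ.IsAlgebraic)
    (hΨu : ∀ v : HeightOneSpectrum (𝓞 K), ((p : ℕ) : 𝓞 K) ∉ v.asIdeal → Ψ.IsUnramifiedAt v)
    {κ₁ κ₂ : ZpExtension K p} {γ₁ γ₂ : absoluteGaloisGroup K}
    (hpair : ZpExtension.IsTopGeneratorPair κ₁ κ₂ γ₁ γ₂) :
    ∃ (M : ℕ) (χ : absoluteGaloisGroup K →ₜ* (PadicAlgCl p)ˣ), 0 < M ∧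
      ∀ n : ℕ,
        IsPAdicAvatarOf ι (Ψ ^ (M * n))
          ((FramedRep.unitsContinuousMulEquivOfUnique (Fin 1) (PadicAlgCl p) :
            (PadicAlgCl p)ˣ →ₜ* GL (Fin 1) (PadicAlgCl p)).comp (χ ^ n)) ∧
        FactorsThroughPair κ₁ κ₂
          ((FramedRep.unitsContinuousMulEquivOfUnique (Fin 1) (PadicAlgCl p) :
            (PadicAlgCl p)ˣ →ₜ* GL (Fin 1) (PadicAlgCl p)).comp (χ ^ n)) := by
  classical
  set e := (FramedRep.unitsContinuousMulEquivOfUnique (Fin 1) (PadicAlgCl p) :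
    (PadicAlgCl p)ˣ →ₜ* GL (Fin 1) (PadicAlgCl p)) with he
  -- Weil's character of `Ψ`, valued in a finite `E/ℚ_p`, and its `ℚ̄_p`-currency `ψa`
  obtain ⟨E, hEfd, a, ha, haΨ⟩ := exists_weilValued ι hΨa
  haveI : CompleteSpace E := FiniteDimensional.complete ℚ_[p] E
  set ιE : (E)ˣ →* (PadicAlgCl p)ˣ :=
    Units.map ((algebraMap E (PadicAlgCl p) : E →+* PadicAlgCl p) : E →* PadicAlgCl p) with hιE
  obtain ⟨ψa, hψa⟩ := exists_unitsChar_of_continuous (p := p) a ha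
  have hψa' : ∀ σ, ψa σ = ιE (a σ) := fun σ => Units.ext (hψa σ)
  have hΨav : IsPAdicAvatarOf ι Ψ (e.comp ψa⁻¹) := by
    rw [isPAdicAvatarOf_unitsChar_iff]
    intro v hv hu
    obtain ⟨h1, h2⟩ := haΨ v hv hu
    refine ⟨fun 𝔓 h𝔓 σ hσ => ?_, fun 𝔓 h𝔓 Φ hΦ => ?_⟩
    · rw [unitsChar_inv_apply, hψa', h1 𝔓 h𝔓 σ hσ, map_one, inv_one]
    · rw [unitsChar_inv_apply, Units.val_inv_eq_inv_val, hψa, h2 𝔓 h𝔓 Φ hΦ]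
  -- the spanning pair and the exponent `M` killing the common kernel
  obtain ⟨Φ₀, Φ₁, -, hspan⟩ := exists_spanningPair (p := p) hK himag
  obtain ⟨M, hM, hMN⟩ := PadicUnits.pow_eq_one_of_forall_character (p := p) (F := E) Φ₀ Φ₁ hspan a ha
  refine ⟨M, ψa⁻¹ ^ M, hM, fun n => ⟨?_, ?_⟩⟩
  · -- avatars of powers
    have h := isPAdicAvatarOf_pow ι hΨav hΨu (M * n)
    rw [← pow_mul]
    exact h
  · -- factoring through the pair
    intro σ h₁ h₂
    have hΦ₀ : Φ₀ σ = 1 := toAdd_eq_zero_of_isTopGeneratorPair hK himag hpair Φ₀ h₁ h₂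
    have hΦ₁ : Φ₁ σ = 1 := toAdd_eq_zero_of_isTopGeneratorPair hK himag hpair Φ₁ h₁ h₂
    have haM : (a σ) ^ M = 1 := hMN σ hΦ₀ hΦ₁
    have hχ : (ψa⁻¹ ^ M) σ = 1 := by
      rw [ContinuousMonoidHom.pow_apply, unitsChar_inv_apply, hψa', inv_pow, ← map_pow, haM,
        map_one, inv_one]
    rw [ContinuousMonoidHom.coe_comp, Function.comp_apply, ContinuousMonoidHom.pow_apply, hχ, one_pow,
      map_one]

end Summit.BirchSwinnertonDyer.BirchSwinnertonDyer.Theorems.CycTangentCMCycTangentBoundPairSupply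

end
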